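import Literature.NumberTheory.EllipticCurves.HidaOrdinaryCohomologyCocycles
import Literature.NumberTheory.EllipticCurves.HidaFamilyMembersOrdinaryRankProofs
import Mathlib.RingTheory.Valuation.LocalSubring
import Mathlib.LinearAlgebra.Eigenspace.Zero
import Mathlib.LinearAlgebra.Charpoly.ToMatrix
import Mathlib.GroupTheory.Schreier
import Mathlib.LinearAlgebra.Matrix.FixedDetMatrices
import Mathlib.FieldTheory.IsAlgClosed.Basic
import HarnessLib

/-!
# Integral structures on spaces of cocycles, reduction modulo the maximal ideal of a valuation
# ring, and decomposition numbers of the Hecke operator `U_p`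

Third file of the cohomological proof of the deep half of Hida's rank constancy (serving the
named fact `Literature.NumberTheory.EllipticCurves.hida_exists_congruent_ordinary_newform`; see
`HidaOrdinaryCohomologySymPow`, `HidaOrdinaryCohomologyCocycles`).  For a field `K`, a valuation
subring `A ⊆ K` with residue field `𝕜`, a level `N ≥ 1` and a degree `n` we prove:

* `Γ₀(N)` is finitely generated (Schreier), so a cocycle is determined by finitely many values
  (`ev`, `ev_injective`) and `cocycles n N K` is finite-dimensional;
* change of rings on cocycles (`mapCocycles`) commutes with `U_p` (`mapCocycles_heckeUZ`); a
  cocycle with values in `A` on a generating set has all its values in `A`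
  (`forall_mem_of_forall_mem_gens`) and lifts to `cocycles n N A` (`liftCocycle`);
* **integral bases by Gaussian elimination with valuation pivoting**
  (`exists_integral_family`, from the tree's `HidaRank.exists_adapted_pivot_family`): a linearly
  independent family of `K`-valued cocycles spans the same space as a family of `A`-valued
  cocycles whose reductions modulo the maximal ideal are still linearly independent, and in which
  every `A`-valued cocycle of the span has coordinates in `A`; hence a `U_p`-stable span has a
  `U_p`-matrix `M` with entries in `A`, reducing to the `U_p`-matrix of the reduced family
  (`exists_integral_hecke_matrix`);
* **decomposition numbers** (`card_filter_isResUnit_add_rootMultiplicity`): for a square matrix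
  `M` over `A` (`K` algebraically closed) the number of eigenvalues of `M` which are units of `A`,
  counted with multiplicity, plus the multiplicity of the eigenvalue `0` of `M mod 𝔪`, is the size
  of `M` (the eigenvalues are integral over `A`, hence in `A`);
* the bookkeeping identities `dim ⨆_{u ∈ P} V_u(φ) = #{roots of χ_φ in P}`
  (`finrank_biSup_maxGenEigenspace_eq_card_roots`) and `χ_{T|span v} = χ_C` for a `T`-stable
  linearly independent family `v` with `T vⱼ = ∑ᵢ Cᵢⱼ vᵢ` (`charpoly_restrict_eq_of_family`).

The outcome (`exists_reduction_count`) is the inequality-free form of Hida's comparison of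
ordinary ranks across a reduction: `#{unit eigenvalues of U_p on span e} =
dim_𝕜 V̄ - dim_𝕜 V̄₀(U_p)` for the span `V̄ ⊆ Z¹(Γ₀(N), Symⁿ(𝕜²))` of the reduced integral basis
(Hida, *Elementary Modular Iwasawa Theory*, §4.2.8–4.2.11: control of the ordinary part under
reduction; here in the elementary form "eigenvalues with multiplicity of an integral matrix and of
its reduction").  Everything is proved; no named facts.

## References

* H. Hida, *Elementary Modular Iwasawa Theory*, World Scientific 2022, §4.2.8–§4.2.11.
  [Hida2022EMI]
* H. Hida, *Galois representations into `GL₂(ℤ_p[[X]])` attached to ordinary cusp forms*,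
  Invent. Math. 85 (1986), §1 ((1.10a)–(1.10b)). [Hida1986]
* J.-P. Serre, *Linear representations of finite groups*, §15 (decomposition, reduction of
  lattices). [folklore]
-/

noncomputable section

open scoped MatrixGroups
open CongruenceSubgroup Matrix Module Module.End IsLocalRing Polynomial

namespace Literature.NumberTheory.EllipticCurves.ModularForms.HidaCohomology

/-! ### Finite generation of `Γ₀(N)`; finitely many values determine a cocycle -/

/-- `SL(2, ℤ)` is finitely generated (by `S` and `T`). [folklore] -/
instance instGroupFG_SL2Z : Group.FG SL(2, ℤ) :=
  Group.fg_iff.mpr ⟨{ModularGroup.S, ModularGroup.T}, SpecialLinearGroup.SL2Z_generators,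
    Set.toFinite _⟩

/-- `Γ₀(N)` has a finite generating set (Schreier's lemma: finite index in `SL(2, ℤ)`). [folklore] -/
theorem exists_finset_closure_eq_top (N : ℕ) [NeZero N] :
    ∃ S : Finset (Gamma0 N), Subgroup.closure (S : Set (Gamma0 N)) = ⊤ :=
  Group.fg_def.mp inferInstance

/-- A chosen finite generating set of `Γ₀(N)`. [folklore] -/
def gens (N : ℕ) [NeZero N] : Finset (Gamma0 N) := (exists_finset_closure_eq_top N).choose

/-- `gens N` generates `Γ₀(N)`. [folklore] -/
theorem closure_gens (N : ℕ) [NeZero N] : Subgroup.closure (gens N : Set (Gamma0 N)) = ⊤ :=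
  (exists_finset_closure_eq_top N).choose_spec

/-- **Evaluation of cocycles on the generators** (coordinatewise). [folklore] -/
def ev (n N : ℕ) [NeZero N] (R : Type*) [CommRing R] :
    cocycles n N R →ₗ[R] (↥(gens N) × Fin (n + 1) → R) where
  toFun u ji := (u : Gamma0 N → Fin (n + 1) → R) ji.1 ji.2
  map_add' _ _ := rfl
  map_smul' _ _ := rfl

section Ev

variable {n N : ℕ} [NeZero N] {R : Type*} [CommRing R]

/-- Unfolding `ev`. [folklore] -/
@[simp] theorem ev_apply (u : cocycles n N R) (ji : ↥(gens N) × Fin (n + 1)) :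
    ev n N R u ji = (u : Gamma0 N → Fin (n + 1) → R) ji.1 ji.2 := rfl

/-- **A cocycle is determined by its values on the generators.** [folklore] -/
theorem ev_injective : Function.Injective (ev n N R) := by
  intro u v h
  rw [← sub_eq_zero]
  apply Subtype.ext
  refine cocycle_eq_zero_of_forall_mem (u - v).2 (closure_gens N) fun s hs ↦ ?_
  funext i
  rw [Submodule.coe_sub, Pi.sub_apply, Pi.sub_apply, Pi.zero_apply, sub_eq_zero]
  exact congrFun h (⟨s, hs⟩, i)

/-- `ker ev = 0`. [folklore] -/
theorem ker_ev : LinearMap.ker (ev n N R) = ⊥ :=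
  LinearMap.ker_eq_bot.mpr ev_injective

/-- **Cocycles over a field form a finite-dimensional space.** [folklore] -/
instance finiteDimensional_cocycles (K : Type*) [Field K] : FiniteDimensional K (cocycles n N K) :=
  FiniteDimensional.of_injective (ev n N K) ev_injective

end Ev

/-! ### Change of rings -/

section MapRing

variable {n N : ℕ} {R S : Type*} [CommRing R] [CommRing S]

/-- The action of integer matrices commutes with ring homomorphisms. [folklore] -/
theorem act_map (φ : R →+* S) (M : Matrix (Fin 2) (Fin 2) ℤ) (a : Fin (n + 1) → R) :
    act n M (φ ∘ a) = φ ∘ act n M a := by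
  funext i
  rw [act_apply, Function.comp_apply, act_apply]
  have hM : M.map (Int.castRingHom S) = (M.map (Int.castRingHom R)).map φ := by
    rw [Matrix.map_map]
    congr 1
    funext x
    simp
  rw [hM, symPow_map, RingHom.map_mulVec]

variable (n N) in
/-- **Change of rings on cocycles** along a ring homomorphism `φ : R → S`. [folklore] -/
def mapCocycles (φ : R →+* S) : cocycles n N R →+ cocycles n N S where
  toFun u := ⟨fun γ ↦ φ ∘ (u : Gamma0 N → Fin (n + 1) → R) γ, by
    rw [mem_cocycles_iff]
    intro γ δ
    have h := (mem_cocycles_iff.mp u.2) γ δ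
    rw [act_map, h]
    funext i
    simp⟩
  map_zero' := by
    apply Subtype.ext
    funext γ i
    simp
  map_add' u v := by
    apply Subtype.ext
    funext γ i
    simp

/-- Unfolding `mapCocycles`. [folklore] -/
@[simp] theorem mapCocycles_apply (φ : R →+* S) (u : cocycles n N R) (γ : Gamma0 N) (i : Fin (n + 1)) :
    (mapCocycles n N φ u : Gamma0 N → Fin (n + 1) → S) γ i =
      φ ((u : Gamma0 N → Fin (n + 1) → R) γ i) := rfl

/-- `mapCocycles` is semilinear. [folklore] -/
theorem mapCocycles_smul (φ : R →+* S) (c : R) (u : cocycles n N R) :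
    mapCocycles n N φ (c • u) = φ c • mapCocycles n N φ u := by
  apply Subtype.ext
  funext γ i
  simp

/-- `mapCocycles` on finite sums with scalars. [folklore] -/
theorem mapCocycles_sum_smul (φ : R →+* S) {ι : Type*} (s : Finset ι) (c : ι → R)
    (u : ι → cocycles n N R) :
    mapCocycles n N φ (∑ i ∈ s, c i • u i) = ∑ i ∈ s, φ (c i) • mapCocycles n N φ (u i) := by
  rw [map_sum]
  exact Finset.sum_congr rfl fun i _ ↦ mapCocycles_smul φ (c i) (u i)

/-- An injective ring homomorphism induces an injective map on cocycles. [folklore] -/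
theorem mapCocycles_injective {φ : R →+* S} (hφ : Function.Injective φ) :
    Function.Injective (mapCocycles n N φ) := by
  intro u v h
  apply Subtype.ext
  funext γ i
  exact hφ (by simpa using congrArg (fun w : cocycles n N S ↦ (w : Gamma0 N → Fin (n + 1) → S) γ i) h)

/-- **Change of rings commutes with `U_p`.** [folklore] -/
theorem mapCocycles_heckeUZ {p : ℕ} [NeZero p] (hp : p.Prime) (φ : R →+* S) (u : cocycles n N R) :
    mapCocycles n N φ (heckeUZ n N R hp u) = heckeUZ n N S hp (mapCocycles n N φ u) := by
  apply Subtype.ext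
  funext γ
  change φ ∘ (heckeU n N R hp u γ) =
    heckeU n N S hp (fun δ ↦ φ ∘ (u : Gamma0 N → Fin (n + 1) → R) δ) γ
  rw [heckeU_apply, heckeU_apply]
  funext i
  simp only [Function.comp_apply, Finset.sum_apply, map_sum]
  refine Finset.sum_congr rfl fun j _ ↦ ?_
  rw [act_map, Function.comp_apply]

variable [NeZero N] in
/-- `ev` commutes with change of rings. [folklore] -/
theorem ev_mapCocycles (φ : R →+* S) (u : cocycles n N R) :
    ev n N S (mapCocycles n N φ u) = φ ∘ ev n N R u := rfl

end MapRing

/-! ### Cocycles with values in a subring -/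

section Integral

variable {n N : ℕ} {K : Type*} [Field K] (A : ValuationSubring K)

/-- The action of integer matrices preserves vectors with entries in a subring. [folklore] -/
theorem act_mem (M : Matrix (Fin 2) (Fin 2) ℤ) {a : Fin (n + 1) → K} (ha : ∀ j, a j ∈ A)
    (i : Fin (n + 1)) : act n M a i ∈ A := by
  set a' : Fin (n + 1) → A := fun j ↦ ⟨a j, ha j⟩
  have h : a = A.subtype ∘ a' := funext fun j ↦ rfl
  rw [h, act_map]
  exact (act n M a' i).2

/-- **Integrality propagates from a generating set**: a cocycle with values in `A` on a set of
generators of `Γ₀(N)` has all its values in `A` (the set where it is integral is a subgroup).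
[folklore] -/
theorem forall_mem_of_forall_mem_gens (u : cocycles n N K) {S : Set (Gamma0 N)}
    (hS : Subgroup.closure S = ⊤)
    (h : ∀ s ∈ S, ∀ i, (u : Gamma0 N → Fin (n + 1) → K) s i ∈ A) :
    ∀ γ i, (u : Gamma0 N → Fin (n + 1) → K) γ i ∈ A := by
  have hu := u.2
  let H : Subgroup (Gamma0 N) :=
    { carrier := {γ | ∀ i, (u : Gamma0 N → Fin (n + 1) → K) γ i ∈ A}
      mul_mem' := fun {γ δ} hγ hδ i ↦ by
        change ∀ i, (u : Gamma0 N → Fin (n + 1) → K) γ i ∈ A at hγ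
        change ∀ i, (u : Gamma0 N → Fin (n + 1) → K) δ i ∈ A at hδ
        rw [(mem_cocycles_iff.mp hu) γ δ, Pi.add_apply]
        exact add_mem (hδ i) (act_mem A _ hγ i)
      one_mem' := fun i ↦ by
        change (u : Gamma0 N → Fin (n + 1) → K) 1 i ∈ A
        rw [cocycle_map_one hu]
        exact zero_mem A
      inv_mem' := fun {γ} hγ i ↦ by
        change ∀ i, (u : Gamma0 N → Fin (n + 1) → K) γ i ∈ A at hγ
        rw [cocycle_map_inv hu γ, Pi.neg_apply]
        exact neg_mem (act_mem A _ hγ i) }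
  have hle : Subgroup.closure S ≤ H := (Subgroup.closure_le H).mpr fun s hs ↦ h s hs
  rw [hS, top_le_iff] at hle
  intro γ
  have : γ ∈ H := hle ▸ Subgroup.mem_top γ
  exact this

/-- **Lifting an `A`-valued cocycle to `cocycles n N A`.** [folklore] -/
def liftCocycle (u : cocycles n N K) (hu : ∀ γ i, (u : Gamma0 N → Fin (n + 1) → K) γ i ∈ A) :
    cocycles n N A :=
  ⟨fun γ i ↦ ⟨(u : Gamma0 N → Fin (n + 1) → K) γ i, hu γ i⟩, by
    rw [mem_cocycles_iff]
    intro γ δ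
    funext i
    apply Subtype.ext
    have h := congrFun ((mem_cocycles_iff.mp u.2) γ δ) i
    rw [Pi.add_apply] at h
    change (u : Gamma0 N → Fin (n + 1) → K) (γ * δ) i =
      ((u : Gamma0 N → Fin (n + 1) → K) δ i) +
        (A.subtype ∘ act n (gmat δ) (fun j ↦ (⟨(u : Gamma0 N → Fin (n + 1) → K) γ j, hu γ j⟩ : A))) i
    rw [← act_map]
    exact h⟩

/-- The lift maps back to the given cocycle. [folklore] -/
@[simp] theorem mapCocycles_liftCocycle (u : cocycles n N K)
    (hu : ∀ γ i, (u : Gamma0 N → Fin (n + 1) → K) γ i ∈ A) :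
    mapCocycles n N A.subtype (liftCocycle A u hu) = u := rfl

end Integral

/-! ### Linear algebra: characteristic polynomial of a stable family; unit-part dimensions -/

section Family

variable {K : Type*} [Field K] {W : Type*} [AddCommGroup W] [Module K W]

/-- A linearly independent family `v` with `T vⱼ = ∑ᵢ Cᵢⱼ vᵢ` spans a `T`-stable subspace.
[folklore] -/
theorem mapsTo_span_of_family {ι : Type*} [Fintype ι] (v : ι → W) (T : Module.End K W)
    (C : Matrix ι ι K) (hT : ∀ j, T (v j) = ∑ i, C i j • v i) :
    ∀ x ∈ Submodule.span K (Set.range v), T x ∈ Submodule.span K (Set.range v) := by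
  intro x hx
  refine Submodule.span_induction (fun w hw ↦ ?_) (by simp) (fun x y _ _ hx hy ↦ ?_)
    (fun c x _ hx ↦ ?_) hx
  · obtain ⟨j, rfl⟩ := hw
    rw [hT j]
    exact Submodule.sum_mem _ fun i _ ↦ Submodule.smul_mem _ _ (Submodule.subset_span ⟨i, rfl⟩)
  · rw [map_add]; exact Submodule.add_mem _ hx hy
  · rw [map_smul]; exact Submodule.smul_mem _ _ hx

/-- The span of a finite family is finite-dimensional. [folklore] -/
instance finite_span_range {ι : Type*} [Finite ι] (v : ι → W) :
    Module.Finite K ↥(Submodule.span K (Set.range v)) :=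
  Module.Finite.span_of_finite K (Set.finite_range v)

/-- **The characteristic polynomial of `T` on the span of a stable linearly independent family
`v` with `T vⱼ = ∑ᵢ Cᵢⱼ vᵢ` is `χ_C`.** [folklore] -/
theorem charpoly_restrict_eq_of_family {ι : Type*} [Fintype ι] [DecidableEq ι] {v : ι → W}
    (hv : LinearIndependent K v) (T : Module.End K W) (C : Matrix ι ι K)
    (hT : ∀ j, T (v j) = ∑ i, C i j • v i) {V : Submodule K W} [Module.Finite K V]
    (hVe : Submodule.span K (Set.range v) = V) (hV : ∀ x ∈ V, T x ∈ V) :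
    (T.restrict hV).charpoly = C.charpoly := by
  subst hVe
  set b := Module.Basis.span hv with hb
  rw [← LinearMap.charpoly_toMatrix (T.restrict hV) b]
  congr 1
  ext i j
  rw [LinearMap.toMatrix_apply]
  have hbj : ((b j : Submodule.span K (Set.range v)) : W) = v j := Module.Basis.coe_span_apply hv j
  have hTb : T.restrict hV (b j) = ∑ i, C i j • b i := by
    apply Subtype.ext
    rw [LinearMap.coe_restrict_apply, hbj, hT j, Submodule.coe_sum]
    refine Finset.sum_congr rfl fun i _ ↦ ?_
    rw [Submodule.coe_smul, Module.Basis.coe_span_apply]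
  rw [hTb, b.repr_sum_self]

/-- **Two stable linearly independent families with the same span have `U`-matrices with the same
characteristic polynomial.** [folklore] -/
theorem charpoly_eq_of_families {ι ι' : Type*} [Fintype ι] [DecidableEq ι] [Fintype ι']
    [DecidableEq ι'] {v : ι → W} {v' : ι' → W} (hv : LinearIndependent K v)
    (hv' : LinearIndependent K v') (T : Module.End K W) (C : Matrix ι ι K) (C' : Matrix ι' ι' K)
    (hT : ∀ j, T (v j) = ∑ i, C i j • v i) (hT' : ∀ j, T (v' j) = ∑ i, C' i j • v' i)
    (hspan : Submodule.span K (Set.range v') = Submodule.span K (Set.range v)) :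
    C.charpoly = C'.charpoly := by
  have hV := mapsTo_span_of_family v T C hT
  rw [← charpoly_restrict_eq_of_family hv T C hT rfl hV,
    ← charpoly_restrict_eq_of_family hv' T C' hT' hspan hV]

/-- **Non-nilpotent rank on the span of a stable family**:
`dim span v - dim (span v)₀(T) = r - mult₀(χ_C)`. [folklore] -/
theorem finrank_span_sub_finrank_maxGenEigenspace_eq {r : ℕ} {v : Fin r → W}
    (hv : LinearIndependent K v) (T : Module.End K W) (C : Matrix (Fin r) (Fin r) K)
    (hT : ∀ j, T (v j) = ∑ i, C i j • v i)
    (hV : ∀ x ∈ Submodule.span K (Set.range v), T x ∈ Submodule.span K (Set.range v)) :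
    finrank K ↥(Submodule.span K (Set.range v)) -
        finrank K ↥(Module.End.maxGenEigenspace (T.restrict hV) 0) =
      r - C.charpoly.rootMultiplicity 0 := by
  rw [finrank_span_eq_card hv, Fintype.card_fin,
    LinearMap.finrank_maxGenEigenspace_eq (T.restrict hV : Module.End K _),
    charpoly_restrict_eq_of_family hv T C hT rfl hV]

variable [FiniteDimensional K W]

/-- Generalised eigenspaces at non-roots of the characteristic polynomial vanish. [folklore] -/
theorem maxGenEigenspace_eq_bot_of_not_mem_roots (φ : Module.End K W) {u : K}
    (hu : u ∉ φ.charpoly.roots) : φ.maxGenEigenspace u = ⊥ := by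
  classical
  have h := LinearMap.finrank_maxGenEigenspace_eq φ u
  rw [← Polynomial.count_roots, Multiset.count_eq_zero_of_notMem hu] at h
  exact Submodule.finrank_eq_zero.mp h

/-- **`dim ⨆_{u ∈ P} W_u(φ) = #{roots of χ_φ satisfying P}`** (with multiplicity), for any
predicate `P` on the scalars. [folklore] -/
theorem finrank_biSup_maxGenEigenspace_eq_card_roots (φ : Module.End K W) (P : K → Prop)
    [DecidablePred P] :
    finrank K ↥(⨆ (u : K) (_ : P u), φ.maxGenEigenspace u) = (φ.charpoly.roots.filter P).card := by
  classical
  set Θ : Finset K := (φ.charpoly.roots.filter P).toFinset with hΘ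
  have hsup : (⨆ (u : K) (_ : P u), φ.maxGenEigenspace u) = ⨆ u ∈ Θ, φ.maxGenEigenspace u := by
    apply le_antisymm
    · refine iSup₂_le fun u hu ↦ ?_
      by_cases hmem : u ∈ φ.charpoly.roots
      · exact le_biSup φ.maxGenEigenspace
          (show u ∈ Θ from Multiset.mem_toFinset.mpr (Multiset.mem_filter.mpr ⟨hmem, hu⟩))
      · rw [maxGenEigenspace_eq_bot_of_not_mem_roots φ hmem]; exact bot_le
    · refine iSup₂_le fun u hu ↦ ?_
      have hu' : P u := (Multiset.mem_filter.mp (Multiset.mem_toFinset.mp hu)).2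
      exact le_iSup₂ (f := fun (u : K) (_ : P u) ↦ φ.maxGenEigenspace u) u hu'
  rw [hsup, HidaRank.finrank_biSup_eq_sum_of_iSupIndep _ φ.independent_maxGenEigenspace Θ,
    ← Multiset.toFinset_sum_count_eq (φ.charpoly.roots.filter P)]
  refine Finset.sum_congr rfl fun u hu ↦ ?_
  have hu' : P u := (Multiset.mem_filter.mp (Multiset.mem_toFinset.mp hu)).2
  rw [LinearMap.finrank_maxGenEigenspace_eq, ← Polynomial.count_roots,
    Multiset.count_filter_of_pos hu']

end Family

/-! ### Integral bases of spaces of cocycles and their reductions -/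

section IntegralFamily

variable {n N : ℕ} [NeZero N] {K : Type*} [Field K] (A : ValuationSubring K)

omit [NeZero N] in
/-- In a pivot family with entries in `A`, a combination with entries in `A` has its coefficients
in `A`. [folklore] -/
theorem coeff_mem_of_pivots {J : Type*} {r : ℕ} (m : Fin r → J → K) (π : Fin r → J)
    (hint : ∀ a j, m a j ∈ A) (hdiag : ∀ a, m a (π a) = 1) (hlow : ∀ a b, a < b → m b (π a) = 0)
    (c : Fin r → K) (hx : ∀ j, (∑ a, c a • m a) j ∈ A) (a : Fin r) : c a ∈ A := by
  suffices h : ∀ (k : ℕ) (a : Fin r), (a : ℕ) = k → c a ∈ A from h a a rfl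
  intro k
  induction k using Nat.strong_induction_on with
  | _ k ih =>
    intro a hak
    have hx' := hx (π a)
    simp only [Finset.sum_apply, Pi.smul_apply, smul_eq_mul] at hx'
    rw [← Finset.add_sum_erase _ _ (Finset.mem_univ a), hdiag, mul_one] at hx'
    have hca : c a = (c a + ∑ b ∈ Finset.univ.erase a, c b * m b (π a)) -
        ∑ b ∈ Finset.univ.erase a, c b * m b (π a) := by ring
    rw [hca]
    refine sub_mem hx' (sum_mem fun b hb ↦ ?_)
    have hba : b ≠ a := Finset.ne_of_mem_erase hb
    rcases lt_or_gt_of_ne hba with hlt | hgt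
    · exact mul_mem (ih b (by omega) b rfl) (hint _ _)
    · rw [hlow a b hgt, mul_zero]; exact zero_mem A

variable (n N) in
/-- **Integral bases by valuation pivoting.** A linearly independent family `e` of `K`-valued
cocycles spans the same space as a family `b` of `A`-valued cocycles (all values in `A`) whose
reductions modulo the maximal ideal of `A` are linearly independent cocycles over the residue
field, and such that every `A`-valued cocycle in the span has its coordinates in `A`.
(Gaussian elimination with pivoting by valuation on the values at a finite generating set of
`Γ₀(N)`, the tree's `HidaRank.exists_adapted_pivot_family`; integrality propagates from the
generators.) [folklore] -/
theorem exists_integral_family {r : ℕ} (e : Fin r → cocycles n N K) (he : LinearIndependent K e) :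
    ∃ b : Fin r → cocycles n N A,
      (∀ a, mapCocycles n N A.subtype (b a) ∈ Submodule.span K (Set.range e)) ∧
      Submodule.span K (Set.range fun a ↦ mapCocycles n N A.subtype (b a)) =
        Submodule.span K (Set.range e) ∧
      LinearIndependent K (fun a ↦ mapCocycles n N A.subtype (b a)) ∧
      LinearIndependent (ResidueField A) (fun a ↦ mapCocycles n N (residue A) (b a)) ∧
      ∀ x ∈ Submodule.span K (Set.range e),
        (∀ γ i, (x : Gamma0 N → Fin (n + 1) → K) γ i ∈ A) →
        ∃ c : Fin r → A, x = ∑ a, (c a : K) • mapCocycles n N A.subtype (b a) := by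
  classical
  -- coordinates on the generators
  set w : Fin r → (↥(gens N) × Fin (n + 1) → K) := fun a ↦ ev n N K (e a) with hw
  have hwli : LinearIndependent K w := he.map' (ev n N K) ker_ev
  obtain ⟨m, π, hint, hdiag, hlow, hspan⟩ := HidaRank.exists_adapted_pivot_family A w hwli
  have hset : ∀ v : Fin r → (↥(gens N) × Fin (n + 1) → K),
      v '' {b : Fin r | (b : ℕ) < r} = Set.range v := fun v ↦ by
    ext x
    simp only [Set.mem_image, Set.mem_setOf_eq, Set.mem_range]
    exact ⟨fun ⟨a, _, ha⟩ ↦ ⟨a, ha⟩, fun ⟨a, ha⟩ ↦ ⟨a, a.2, ha⟩⟩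
  have hspan' : Submodule.span K (Set.range m) = Submodule.span K (Set.range w) := by
    rw [← hset m, ← hset w]; exact hspan r
  have hrange : Set.range w = ev n N K '' Set.range e := by
    rw [hw, ← Set.range_comp]; rfl
  have hmapspan : Submodule.span K (Set.range w) =
      (Submodule.span K (Set.range e)).map (ev n N K) := by
    rw [hrange, Submodule.span_image]
  -- each `m a` is `ev` of a cocycle in the span of `e`
  have hm : ∀ a, ∃ x ∈ Submodule.span K (Set.range e), ev n N K x = m a := by
    intro a
    have : m a ∈ (Submodule.span K (Set.range e)).map (ev n N K) := by
      rw [← hmapspan, ← hspan']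
      exact Submodule.subset_span ⟨a, rfl⟩
    exact Submodule.mem_map.mp this
  choose x hxmem hxev using hm
  -- integrality of all the values
  have hxint : ∀ a γ i, (x a : Gamma0 N → Fin (n + 1) → K) γ i ∈ A := by
    intro a
    refine forall_mem_of_forall_mem_gens A (x a) (closure_gens N) fun s hs i ↦ ?_
    have h := congrFun (hxev a) (⟨s, hs⟩, i)
    rw [ev_apply] at h
    rw [h]
    exact hint a _
  set b : Fin r → cocycles n N A := fun a ↦ liftCocycle A (x a) (hxint a) with hb
  have hbK : ∀ a, mapCocycles n N A.subtype (b a) = x a := fun a ↦ rfl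
  have hevb : (ev n N K) ∘ (fun a ↦ mapCocycles n N A.subtype (b a)) = m :=
    funext fun a ↦ by rw [Function.comp_apply, hbK, hxev]
  have hspanEq : Submodule.span K (Set.range fun a ↦ mapCocycles n N A.subtype (b a)) =
      Submodule.span K (Set.range e) := by
    apply Submodule.map_injective_of_injective (f := ev n N K) ev_injective
    rw [← hmapspan, ← hspan', ← Submodule.span_image, ← Set.range_comp, hevb]
  refine ⟨b, fun a ↦ hxmem a, hspanEq, ?_, ?_, ?_⟩
  · apply LinearIndependent.of_comp (ev n N K)
    rw [hevb]
    exact HidaRank.linearIndependent_of_pivots m π hdiag hlow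
  · apply LinearIndependent.of_comp (ev n N (ResidueField A))
    set mbar : Fin r → (↥(gens N) × Fin (n + 1) → ResidueField A) :=
      fun a j ↦ residue A ⟨m a j, hint a j⟩ with hmbar
    have hcomp : (ev n N (ResidueField A)) ∘
        (fun a ↦ mapCocycles n N (residue A) (b a)) = mbar := by
      funext a j
      rw [Function.comp_apply, ev_mapCocycles, Function.comp_apply, hmbar]
      congr 1
      apply Subtype.ext
      change (x a : Gamma0 N → Fin (n + 1) → K) j.1.1 j.2 = m a j
      rw [← hxev a, ev_apply]
    rw [hcomp]
    refine HidaRank.linearIndependent_of_pivots mbar π (fun a ↦ ?_) (fun a c hac ↦ ?_)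
    · have h1 : (⟨m a (π a), hint a (π a)⟩ : A) = 1 := Subtype.ext (hdiag a)
      simp only [hmbar]
      rw [h1, map_one]
    · have h0 : (⟨m c (π a), hint c (π a)⟩ : A) = 0 := Subtype.ext (hlow a c hac)
      simp only [hmbar]
      rw [h0, map_zero]
  · intro y hy hyint
    rw [← hspanEq] at hy
    obtain ⟨c, hc⟩ := (Submodule.mem_span_range_iff_exists_fun K).mp hy
    have hcA : ∀ a, c a ∈ A := by
      refine coeff_mem_of_pivots A m π hint hdiag hlow c (fun j ↦ ?_)
      have h : ev n N K y = ∑ a, c a • m a := by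
        rw [← hc, map_sum]
        refine Finset.sum_congr rfl fun a _ ↦ ?_
        rw [map_smul]
        congr 1
        exact congrFun hevb a
      have h' : (∑ a, c a • m a) j = (y : Gamma0 N → Fin (n + 1) → K) j.1 j.2 := by
        rw [← h, ev_apply]
      rw [h']
      exact hyint _ _
    refine ⟨fun a ↦ ⟨c a, hcA a⟩, ?_⟩
    rw [← hc]

/-- **An integral `U_p`-matrix.** If the span of the linearly independent family `e` is
`U_p`-stable, the integral basis `b` of `exists_integral_family` has a `U_p`-matrix `M` with
entries in `A`, and `M mod 𝔪` is the `U_p`-matrix of the reduced family. [folklore] -/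
theorem exists_integral_hecke_matrix {p : ℕ} [NeZero p] (hp : p.Prime) {r : ℕ}
    (e : Fin r → cocycles n N K) (he : LinearIndependent K e)
    (hstab : ∀ x ∈ Submodule.span K (Set.range e),
      heckeUZ n N K hp x ∈ Submodule.span K (Set.range e)) :
    ∃ (b : Fin r → cocycles n N A) (M : Matrix (Fin r) (Fin r) A),
      (∀ a, mapCocycles n N A.subtype (b a) ∈ Submodule.span K (Set.range e)) ∧
      Submodule.span K (Set.range fun a ↦ mapCocycles n N A.subtype (b a)) =
        Submodule.span K (Set.range e) ∧
      LinearIndependent K (fun a ↦ mapCocycles n N A.subtype (b a)) ∧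
      LinearIndependent (ResidueField A) (fun a ↦ mapCocycles n N (residue A) (b a)) ∧
      (∀ j, heckeUZ n N K hp (mapCocycles n N A.subtype (b j)) =
        ∑ i, (M i j : K) • mapCocycles n N A.subtype (b i)) ∧
      (∀ j, heckeUZ n N (ResidueField A) hp (mapCocycles n N (residue A) (b j)) =
        ∑ i, residue A (M i j) • mapCocycles n N (residue A) (b i)) := by
  obtain ⟨b, hbmem, hspan, hliK, hlik, hcoef⟩ := exists_integral_family n N A e he
  have hU : ∀ j, ∃ c : Fin r → A, heckeUZ n N K hp (mapCocycles n N A.subtype (b j)) =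
      ∑ a, (c a : K) • mapCocycles n N A.subtype (b a) := by
    intro j
    refine hcoef _ (hstab _ (hbmem j)) fun γ i ↦ ?_
    rw [← mapCocycles_heckeUZ, mapCocycles_apply]
    exact Subtype.coe_prop _
  choose c hc using hU
  refine ⟨b, fun i j ↦ c j i, hbmem, hspan, hliK, hlik, fun j ↦ hc j, fun j ↦ ?_⟩
  have hA : heckeUZ n N A hp (b j) = ∑ i, c j i • b i := by
    apply mapCocycles_injective (φ := A.subtype) Subtype.val_injective
    rw [mapCocycles_heckeUZ, hc j, mapCocycles_sum_smul]
    rfl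
  rw [← mapCocycles_heckeUZ, hA, mapCocycles_sum_smul]

end IntegralFamily

/-! ### Decomposition numbers: unit eigenvalues of an integral matrix and its reduction -/

section Decomposition

variable {K : Type*} [Field K] (A : ValuationSubring K)

/-- **Residual units**: the elements of `K` lying in `A` with non-zero residue. [folklore] -/
def IsResUnit (z : K) : Prop := ∃ a : A, (a : K) = z ∧ residue A a ≠ 0

/-- For `a ∈ A`: `a` is a residual unit iff its residue is non-zero. [folklore] -/
theorem isResUnit_coe_iff (a : A) : IsResUnit A (a : K) ↔ residue A a ≠ 0 := by
  constructor
  · rintro ⟨a', ha', h⟩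
    have : a' = a := Subtype.ext ha'
    rwa [this] at h
  · exact fun h ↦ ⟨a, rfl, h⟩

open scoped Classical in
/-- A retraction `K → A` (identity on `A`). [folklore] -/
def toA (z : K) : A := if h : z ∈ A then ⟨z, h⟩ else 0

/-- `toA` is the identity on `A`. [folklore] -/
theorem coe_toA {z : K} (hz : z ∈ A) : (toA A z : K) = z := by
  rw [toA, dif_pos hz]

/-- **Decomposition numbers.** For a square matrix `M` over a valuation ring `A` of an
algebraically closed field `K`: the number of eigenvalues of `M` in `K` (with multiplicity) which
are units of `A`, plus the multiplicity of the eigenvalue `0` of `M mod 𝔪`, equals the size of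
`M`.  (The eigenvalues are integral over the integrally closed `A`, hence `χ_M = ∏ (X - tᵢ)` over
`A`, and `χ_{M mod 𝔪} = ∏ (X - t̄ᵢ)`.) [folklore] -/
theorem card_filter_isResUnit_add_rootMultiplicity [IsAlgClosed K] {ι : Type*} [Fintype ι]
    [DecidableEq ι] [DecidablePred (IsResUnit A)] (M : Matrix ι ι A) :
    ((M.map A.subtype).charpoly.roots.filter (IsResUnit A)).card +
      (M.map (residue A)).charpoly.rootMultiplicity 0 = Fintype.card ι := by
  classical
  set P : A[X] := M.charpoly with hP
  have hPmonic : P.Monic := Matrix.charpoly_monic M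
  have hPK : (M.map A.subtype).charpoly = P.map A.subtype := Matrix.charpoly_map M _
  have hPk : (M.map (residue A)).charpoly = P.map (residue A) := Matrix.charpoly_map M _
  set T : Multiset K := (P.map A.subtype).roots with hT
  have hmonicK : (P.map A.subtype).Monic := hPmonic.map _
  have hTcard : T.card = (P.map A.subtype).natDegree := IsAlgClosed.card_roots_eq_natDegree
  -- all the roots lie in `A`
  have hTA : ∀ z ∈ T, z ∈ A := by
    intro z hz
    have hroot := Polynomial.isRoot_of_mem_roots hz
    rw [Polynomial.IsRoot.def, Polynomial.eval_map] at hroot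
    have hz_int : IsIntegral A z := ⟨P, hPmonic, hroot⟩
    obtain ⟨y, hy⟩ := IsIntegrallyClosed.algebraMap_eq_of_integral hz_int
    rw [← hy]
    exact y.2
  set T' : Multiset A := T.map (toA A) with hT'
  have hT'T : T'.map A.subtype = T := by
    rw [hT', Multiset.map_map]
    conv_rhs => rw [← Multiset.map_id T]
    exact Multiset.map_congr rfl fun z hz ↦ coe_toA A (hTA z hz)
  -- `P = ∏ (X - t')` over `A`
  have hcompK : (Polynomial.map A.subtype ∘ fun t : A ↦ X - C t) = (fun z : K ↦ X - C z) ∘ A.subtype :=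
    funext fun t ↦ by simp
  have hPprod : P = (T'.map fun t ↦ X - C t).prod := by
    apply Polynomial.map_injective A.subtype Subtype.val_injective
    rw [Polynomial.map_multiset_prod, Multiset.map_map, hcompK, ← Multiset.map_map, hT'T, hT,
      Polynomial.prod_multiset_X_sub_C_of_monic_of_roots_card_eq hmonicK hTcard]
  have hcompk : (Polynomial.map (residue A) ∘ fun t : A ↦ X - C t) =
      (fun z ↦ X - C z) ∘ residue A := funext fun t ↦ by simp
  have hPkroots : (P.map (residue A)).roots = T'.map (residue A) := by
    rw [hPprod, Polynomial.map_multiset_prod, Multiset.map_map, hcompk, ← Multiset.map_map,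
      Polynomial.roots_multiset_prod_X_sub_C]
  -- count
  rw [hPK, hPk, ← Polynomial.count_roots, hPkroots, Multiset.count_map, ← hT, ← hT'T,
    Multiset.filter_map, Multiset.card_map]
  have h1 : T'.filter (IsResUnit A ∘ A.subtype) = T'.filter (fun t ↦ residue A t ≠ 0) :=
    Multiset.filter_congr fun t _ ↦ by
      rw [Function.comp_apply]
      exact isResUnit_coe_iff A t
  have h2 : T'.filter (fun a ↦ (0 : ResidueField A) = residue A a) =
      T'.filter (fun t ↦ ¬ residue A t ≠ 0) :=
    Multiset.filter_congr fun t _ ↦ by rw [not_not, eq_comm]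
  rw [h1, h2, ← Multiset.card_add, Multiset.filter_add_not, hT', Multiset.card_map, hTcard, ← hPK,
    Matrix.charpoly_natDegree_eq_dim]

end Decomposition

/-! ### The reduction count for a `U_p`-stable family of cocycles -/

/-- **Reduction count for `U_p` on a stable family of cocycles.** Let `e` be a linearly
independent family of `r` cocycles over an algebraically closed field `K` with `U_p`-matrix `Ae`
(`U_p eⱼ = ∑ᵢ (Ae)ᵢⱼ eᵢ`), and `A ⊆ K` a valuation subring with residue field `𝕜`.  Then there are
`A`-valued cocycles `b₁, …, b_r` in the span of `e` whose reductions `b̄ₐ` are linearly independent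
cocycles over `𝕜` spanning a `U_p`-stable subspace with `U_p`-matrix `M mod 𝔪` for an integral
matrix `M`, and **the number of eigenvalues of `U_p` on `span e` which are units of `A` equals
`r - mult₀(χ_{M mod 𝔪})`** — the dimension of `span b̄` minus that of its generalised
`0`-eigenspace (`finrank_span_sub_finrank_maxGenEigenspace_eq`).  This is the elementary core of
Hida's control of the ordinary rank under reduction modulo `p`. [cite: Hida2022EMI, §4.2.8] -/
theorem exists_reduction_count {n N : ℕ} [NeZero N] {K : Type*} [Field K] [IsAlgClosed K]
    (A : ValuationSubring K) [DecidablePred (IsResUnit A)] {p : ℕ} [NeZero p] (hp : p.Prime)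
    {r : ℕ} (e : Fin r → cocycles n N K) (he : LinearIndependent K e)
    (Ae : Matrix (Fin r) (Fin r) K) (hAe : ∀ j, heckeUZ n N K hp (e j) = ∑ i, Ae i j • e i) :
    ∃ (b : Fin r → cocycles n N A) (M : Matrix (Fin r) (Fin r) A),
      (∀ a, mapCocycles n N A.subtype (b a) ∈ Submodule.span K (Set.range e)) ∧
      LinearIndependent (ResidueField A) (fun a ↦ mapCocycles n N (residue A) (b a)) ∧
      (∀ j, heckeUZ n N (ResidueField A) hp (mapCocycles n N (residue A) (b j)) =
        ∑ i, (M.map (residue A)) i j • mapCocycles n N (residue A) (b i)) ∧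
      (Ae.charpoly.roots.filter (IsResUnit A)).card +
        (M.map (residue A)).charpoly.rootMultiplicity 0 = r := by
  obtain ⟨b, M, hbmem, hspan, hliK, hlik, hUK, hUk⟩ :=
    exists_integral_hecke_matrix A hp e he (mapsTo_span_of_family e (heckeUZ n N K hp) Ae hAe)
  refine ⟨b, M, hbmem, hlik, fun j ↦ ?_, ?_⟩
  · rw [hUk j]
    exact Finset.sum_congr rfl fun i _ ↦ by rw [Matrix.map_apply]
  have hUK' : ∀ j, heckeUZ n N K hp (mapCocycles n N A.subtype (b j)) =
      ∑ i, (M.map A.subtype) i j • mapCocycles n N A.subtype (b i) := fun j ↦ by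
    rw [hUK j]
    exact Finset.sum_congr rfl fun i _ ↦ by rw [Matrix.map_apply]; rfl
  have h12 : Ae.charpoly = (M.map A.subtype).charpoly :=
    charpoly_eq_of_families he hliK _ Ae (M.map A.subtype) hAe hUK' hspan
  have h := card_filter_isResUnit_add_rootMultiplicity A M
  rw [Fintype.card_fin, ← h12] at h
  exact h

end Literature.NumberTheory.EllipticCurves.ModularForms.HidaCohomology
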